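import Literature.Analysis.Convolution.DixmierMalliavinProduct
import Literature.Analysis.Convolution.DixmierMalliavinAnnulus
import Literature.Analysis.Complex.StripShiftFourierDecay
import HarnessLib

/-!
# The Dixmier–Malliavin kernel on `ℝ`, II: exponential decay of the kernels `ψ_k` and the
# uniform annulus bounds on all derivatives

Topic `Literature/Analysis/Convolution`; namespace `Literature.Analysis.Convolution.DixmierMalliavin`.
Second module of the discharge of `Literature.Analysis.Convolution.DixmierMalliavin_real`
([DixmierMalliavin1978, Thm. 3.1]; blueprint [Hegde2021, §3.1 Lemma 10, §3.2 Lemma 14]); see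
`DixmierMalliavinProduct.lean` for part I (the kernels `psi c k = ψ_k = 𝓕 r_k`,
`r_k = ∏_{n≥k}(1 + (2πcₙξ)²)⁻¹`, and the recursion `ψ_k − ψ_{k+1} = c_k² ψ_k''`).

* `IsAdmissible.norm_fourier_tailFin_le` — the finite products: `|𝓕(r_{k,N})(x)| ≤ (3/4) c_k⁻¹ e^{−|x|/(2c_k)}`
  for `k < N`, by the strip contour shift to `|Im ζ| = 1/(4π c_k)` (the tree's
  `Literature.Analysis.Complex.norm_fourier_inv_prod_one_add_sq_le`, seat cc-t4) and the Weierstrass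
  product inequality `∏(1 − (cₙ/2c_k)²) ≥ 1 − Σ ≥ 2/3`.
* `IsAdmissible.tendsto_fourier_tailFin` — `𝓕(r_{k,N})(x) → ψ_k(x)` (dominated convergence), hence
  `IsAdmissible.norm_psi_le : ‖ψ_k(x)‖ ≤ (3/4) c_k⁻¹ e^{−|x|/(2c_k)}` UNIFORMLY over the admissible class.
* `exists_annulus_bound` — `∃ K : ℕ → ℝ, ∀ c admissible, ∀ n k, ∀ |x| ≥ 1, ‖ψ_k^{(n)}(x)‖ ≤ K n`: the
  recursion fed into the generic kernel-chain estimates of `DixmierMalliavinAnnulus.lean`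
  (`KernelChain.exists_uniform_norm_iteratedDeriv_le_complex_of_global_decay`, seat cc-t11): even
  orders through `ψ_k^{(2m)} = Σ_j α_{m,j} ψ_{k+j}`, odd orders by the interpolation
  `|u′| ≤ 2 sup|u| + sup|u″|` on unit intervals.  This replaces [Hegde2021, Claim 13], whose global
  (`sup_ℝ`) form cannot hold; only the annulus form is needed in Lemma 14.

RH-context: pure classical analysis (the one classical input of the off-path strong form of
Connes–Consani 2021 Thm. 4.7); nothing here bears on the truth of RH.
-/

noncomputable section

open MeasureTheory Filter Complex Set Finset
open scoped Topology Real BigOperators FourierTransform ContDiff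

namespace Literature.Analysis.Convolution

namespace DixmierMalliavin

variable {c : ℕ → ℝ}

/-- Weierstrass' product inequality `1 − Σ aᵢ ≤ ∏ (1 − aᵢ)` for `aᵢ ∈ [0,1]` (plumbing). [folklore] -/
private theorem one_sub_sum_le_prod' {ι : Type*} (s : Finset ι) (a : ι → ℝ)
    (h0 : ∀ i ∈ s, 0 ≤ a i) (h1 : ∀ i ∈ s, a i ≤ 1) :
    1 - ∑ i ∈ s, a i ≤ ∏ i ∈ s, (1 - a i) := by
  classical
  induction s using Finset.induction_on with
  | empty => simp
  | insert j s hj ih =>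
    rw [Finset.sum_insert hj, Finset.prod_insert hj]
    have h0' : ∀ i ∈ s, 0 ≤ a i := fun i hi => h0 i (Finset.mem_insert_of_mem hi)
    have h1' : ∀ i ∈ s, a i ≤ 1 := fun i hi => h1 i (Finset.mem_insert_of_mem hi)
    have hP1 : ∏ i ∈ s, (1 - a i) ≤ 1 :=
      Finset.prod_le_one (fun i hi => sub_nonneg.2 (h1' i hi)) fun i hi => sub_le_self _ (h0' i hi)
    have haj0 := h0 j (Finset.mem_insert_self j s)
    have haj1 := h1 j (Finset.mem_insert_self j s)
    nlinarith [ih h0' h1', mul_nonneg haj0 (sub_nonneg.2 hP1)]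

/-- The finite tail products in the shape of the strip-shift lemma:
`r_{k,N}(ξ) = (∏_{n ∈ [k,N)} (1 + ((2πcₙ) ξ)²))⁻¹`. [cite: Hegde2021, §3.1 Lemma 10 (p. 6)] -/
theorem tailFin_eq_inv_prod (c : ℕ → ℝ) (k N : ℕ) (ξ : ℝ) :
    tailFin c k N ξ = (∏ n ∈ Finset.Ico k N, (1 + (2 * π * c n * ξ) ^ 2))⁻¹ := by
  unfold tailFin qf
  rw [← Finset.prod_inv_distrib]

/-- **Exponential decay of the finite products' transforms**, uniformly in `N > k`:
`|𝓕(r_{k,N})(x)| ≤ (3/4) c_k⁻¹ e^{−|x|/(2c_k)}` (contour shift to `|Im ζ| = 1/(4π c_k)`: the factor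
`n = k` keeps `3/4` of its size, the others lose at most `∏(1 − (cₙ/2c_k)²) ≥ 2/3` in total).
[cite: Hegde2021, §3.2 Claim 13 / Lemma 14 (p. 7)] -/
theorem IsAdmissible.norm_fourier_tailFin_le (hc : IsAdmissible c) {k N : ℕ} (hkN : k < N) (x : ℝ) :
    ‖𝓕 (fun ξ : ℝ => ((tailFin c k N ξ : ℝ) : ℂ)) x‖ ≤ 3 / 4 / c k * Real.exp (-(|x| / (2 * c k))) := by
  have hck := hc.pos k
  set a : ℕ → ℝ := fun n => 2 * π * c n with ha_def
  set η : ℝ := 1 / (4 * π * c k) with hη_def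
  have hη0 : 0 ≤ η := by positivity
  have ha0 : ∀ n, 0 < a n := fun n => by have := hc.pos n; rw [ha_def]; positivity
  have hfun : (fun ξ : ℝ => ((tailFin c k N ξ : ℝ) : ℂ)) =
      fun ξ : ℝ => (((∏ n ∈ Finset.Ico k N, (1 + (a n * ξ) ^ 2))⁻¹ : ℝ) : ℂ) := by
    funext ξ; rw [tailFin_eq_inv_prod]
  have hmem : k ∈ Finset.Ico k N := Finset.mem_Ico.2 ⟨le_rfl, hkN⟩
  have haη : ∀ n ∈ Finset.Ico k N, a n * η = c n / (2 * c k) := by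
    intro n _; rw [ha_def, hη_def]; field_simp; ring
  have haη' : ∀ n ∈ Finset.Ico k N, a n * η < 1 := by
    intro n hn
    rw [haη n hn, div_lt_one (by positivity)]
    have := hc.antitone (Finset.mem_Ico.1 hn).1
    linarith [hc.pos n]
  have hmain := Literature.Analysis.Complex.norm_fourier_inv_prod_one_add_sq_le (Finset.Ico k N) a
    hmem (fun n _ => (ha0 n).le) (ha0 k) hη0 haη' x
  rw [← hfun] at hmain
  refine hmain.trans ?_
  -- the Weierstrass bound on the lost product
  have hprod : 2 / 3 ≤ ∏ n ∈ Finset.Ico k N, (1 - (a n * η) ^ 2) := by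
    have h0 : ∀ n ∈ Finset.Ico k N, 0 ≤ (a n * η) ^ 2 := fun n _ => sq_nonneg _
    have h1 : ∀ n ∈ Finset.Ico k N, (a n * η) ^ 2 ≤ 1 := fun n hn => by
      have := haη' n hn
      have h' : 0 ≤ a n * η := mul_nonneg (ha0 n).le hη0
      nlinarith
    refine le_trans ?_ (one_sub_sum_le_prod' _ _ h0 h1)
    have hsum : ∑ n ∈ Finset.Ico k N, (a n * η) ^ 2 ≤ 1 / 3 := by
      calc ∑ n ∈ Finset.Ico k N, (a n * η) ^ 2 = (∑ n ∈ Finset.Ico k N, c n ^ 2) / (4 * c k ^ 2) := by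
            rw [Finset.sum_div]
            refine Finset.sum_congr rfl fun n hn => ?_
            rw [haη n hn]; field_simp; ring
        _ ≤ (4 / 3 * c k ^ 2) / (4 * c k ^ 2) :=
            div_le_div_of_nonneg_right (hc.sum_sq_Ico_le k N) (by positivity)
        _ = 1 / 3 := by field_simp
    linarith
  have hexp : Real.exp (-(2 * π * η * |x|)) = Real.exp (-(|x| / (2 * c k))) := by
    congr 1; rw [hη_def]; field_simp; ring
  rw [hexp, show π / a k = 1 / (2 * c k) by rw [ha_def]; field_simp]
  have hinv : (∏ n ∈ Finset.Ico k N, (1 - (a n * η) ^ 2))⁻¹ ≤ 3 / 2 := by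
    rw [inv_le_comm₀ (lt_of_lt_of_le (by norm_num) hprod) (by norm_num)]
    linarith
  calc 1 / (2 * c k) * (∏ n ∈ Finset.Ico k N, (1 - (a n * η) ^ 2))⁻¹ * Real.exp (-(|x| / (2 * c k)))
      ≤ 1 / (2 * c k) * (3 / 2) * Real.exp (-(|x| / (2 * c k))) := by
        gcongr
  _ = 3 / 4 / c k * Real.exp (-(|x| / (2 * c k))) := by ring

/-- `𝓕(r_{k,N})(x) → ψ_k(x)` as `N → ∞` (dominated convergence on the Fourier integrand; dominator
`(1 + (2π c_k ξ)²)⁻¹` for `N > k`). [cite: Hegde2021, §3.1 Lemma 10 (p. 6)] -/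
theorem IsAdmissible.tendsto_fourier_tailFin (hc : IsAdmissible c) (k : ℕ) (x : ℝ) :
    Tendsto (fun N => 𝓕 (fun ξ : ℝ => ((tailFin c k N ξ : ℝ) : ℂ)) x) atTop (𝓝 (psi c k x)) := by
  simp only [psi, Real.fourier_real_eq_integral_exp_smul]
  have hck := hc.pos k
  refine tendsto_integral_filter_of_dominated_convergence (fun v => (1 + (2 * π * c k * v) ^ 2)⁻¹)
    (Eventually.of_forall fun N => ?_) ?_ ?_ (Eventually.of_forall fun v => ?_)
  · exact ((by fun_prop : Continuous fun v : ℝ => cexp (↑(-2 * π * v * x) * I)).smul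
      (Complex.continuous_ofReal.comp (continuous_tailFin c k N))).aestronglyMeasurable
  · filter_upwards [eventually_gt_atTop k] with N hN
    refine Eventually.of_forall fun v => ?_
    rw [norm_smul, Complex.norm_exp_ofReal_mul_I, one_mul, Complex.norm_real, Real.norm_eq_abs,
      abs_of_nonneg (tailFin_pos c k N v).le]
    calc tailFin c k N v ≤ tailFin c k (k + 1) v := tailFin_antitone c k v (by omega)
      _ = (1 + (2 * π * c k * v) ^ 2)⁻¹ := by simp [tailFin, qf]
  · exact integrable_inv_one_add_sq.comp_mul_left' (mul_pos (by positivity) hck).ne'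
  · exact ((Complex.continuous_ofReal.tendsto _).comp (tendsto_tailFin c k v)).const_smul _

/-- **Exponential decay of the kernels, uniformly over the admissible class**:
`‖ψ_k(x)‖ ≤ (3/4) c_k⁻¹ e^{−|x|/(2c_k)}`. [cite: Hegde2021, §3.2 Claim 13 / Lemma 14 (p. 7)] -/
theorem IsAdmissible.norm_psi_le (hc : IsAdmissible c) (k : ℕ) (x : ℝ) :
    ‖psi c k x‖ ≤ 3 / 4 / c k * Real.exp (-(|x| / (2 * c k))) :=
  le_of_tendsto (hc.tendsto_fourier_tailFin k x).norm
    (eventually_atTop.2 ⟨k + 1, fun N hN => hc.norm_fourier_tailFin_le (by omega) x⟩)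

/-- The recursion in the normal form of the kernel-chain estimates:
`ψ_k'' = (ψ_k − ψ_{k+1})/c_k²`. [cite: Hegde2021, §3.1 Lemma 10 (p. 6)] -/
theorem IsAdmissible.iteratedDeriv_two_psi (hc : IsAdmissible c) (k : ℕ) (x : ℝ) :
    iteratedDeriv 2 (psi c k) x = (psi c k x - psi c (k + 1) x) / ((c k : ℂ)) ^ 2 := by
  have hck : ((c k : ℂ)) ^ 2 ≠ 0 := pow_ne_zero _ (Complex.ofReal_ne_zero.2 (hc.pos k).ne')
  rw [eq_div_iff hck, hc.psi_sub_psi_succ k x, mul_comm]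

/-- **Uniform annulus bounds on all derivatives of the kernels** (the corrected form of
[Hegde2021, Claim 13]): there are constants `K_n`, depending on nothing, with
`‖ψ_k^{(n)}(x)‖ ≤ K_n` for every admissible scale sequence, every `k` and every `|x| ≥ 1`.
[cite: Hegde2021, §3.2 Claim 13 / Lemma 14 (p. 7)] -/
theorem exists_annulus_bound :
    ∃ K : ℕ → ℝ, ∀ c : ℕ → ℝ, IsAdmissible c →
      ∀ (n k : ℕ) (x : ℝ), 1 ≤ |x| → ‖iteratedDeriv n (psi c k) x‖ ≤ K n := by
  obtain ⟨K, hK⟩ :=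
    KernelChain.exists_uniform_norm_iteratedDeriv_le_complex_of_global_decay (3 / 4) 1 one_pos
  exact ⟨K, fun c hc n k x hx => hK (psi c) c hc.pos hc.antitone hc.contDiff_psi
    hc.iteratedDeriv_two_psi hc.norm_psi_le n k x hx⟩

/-- **Export (D) for the assembly module** (`DixmierMalliavinKernel.lean`, seat cc-t4): the annulus
bounds for the head kernel `ψ₀` from `|x| ≥ 1/2` on, uniformly over the admissible class.
[cite: Hegde2021, §3.2 Claim 13 / Lemma 14 (p. 7)] -/
theorem exists_annulus_bound_half :
    ∃ K : ℕ → ℝ, ∀ c : ℕ → ℝ, IsAdmissible c →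
      ∀ (n : ℕ) (x : ℝ), (1 : ℝ) / 2 ≤ |x| → ‖iteratedDeriv n (psi c 0) x‖ ≤ K n := by
  obtain ⟨K, hK⟩ :=
    KernelChain.exists_uniform_norm_iteratedDeriv_le_complex_of_global_decay (3 / 4) ((1 : ℝ) / 2)
      one_half_pos
  exact ⟨K, fun c hc n x hx => hK (psi c) c hc.pos hc.antitone hc.contDiff_psi
    hc.iteratedDeriv_two_psi hc.norm_psi_le n 0 x hx⟩

/-- The general form: annulus bounds from any `s > 0` on, all kernels `ψ_k`, uniformly over the
admissible class. [cite: Hegde2021, §3.2 Claim 13 / Lemma 14 (p. 7)] -/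
theorem exists_annulus_bound_of_pos {s : ℝ} (hs : 0 < s) :
    ∃ K : ℕ → ℝ, ∀ c : ℕ → ℝ, IsAdmissible c →
      ∀ (n k : ℕ) (x : ℝ), s ≤ |x| → ‖iteratedDeriv n (psi c k) x‖ ≤ K n := by
  obtain ⟨K, hK⟩ :=
    KernelChain.exists_uniform_norm_iteratedDeriv_le_complex_of_global_decay (3 / 4) s hs
  exact ⟨K, fun c hc n k x hx => hK (psi c) c hc.pos hc.antitone hc.contDiff_psi
    hc.iteratedDeriv_two_psi hc.norm_psi_le n k x hx⟩

end DixmierMalliavin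

end Literature.Analysis.Convolution
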